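import Literature.NumberTheory.EllipticCurves.LocalIndexBadPoints
import Literature.NumberTheory.DiophantineGeometry.TateAlgorithmIstarNonzeroProofs
import HarnessLib

/-!
# The local index for type `I₀*`: `c_v ∈ {1, 2, 4}` (proof)

Discharge of the named fact
`Literature.NumberTheory.EllipticCurves.localTamagawaNumber_of_kodairaSymbolAt_eq_Istar_zero`
(`NeronComponentIndex.lean`; Silverman, *ATAEC*, IV.9.4 Step 6, PDF p. 345: "Type `I₀*`, …,
`c = 1 + #{α ∈ k : P(α) = 0}`"), in the recorded form `c_v ∈ {1, 2, 4}`, by the elementary tools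
of `LocalIndexBadPoints.lean`; no Néron model is used, and — since only an upper bound and a
parity constraint are needed — no Hensel lifting either.

## Proof

Let `R` be a discrete valuation ring with perfect residue field `k` and `I` an equation over `R`
with `Δ ≠ 0` for which Tate's algorithm returns `Istar 0`. By
`kodairaSymbolOfMinimal_eq_Istar_zero_imp` (`TateAlgorithmIstarNonzeroProofs`: the junk `Istar 0`
of Step 7 does not occur) Step 6 fired, so some `R`-model `J = D • I` has `π ∣ a₁, a₂`,
`π² ∣ a₃, a₄`, `π³ ∣ a₆` and a cubic `P(T) = T³ + a₂,₁T² + a₄,₂T + a₆,₃` with three distinct roots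
in `k̄` (`exists_smul_of_kodairaSymbolOfMinimal_eq_Istar_zero`). A bad point of `J` is an integral
point `(πx₁, π²y₂)` with `P(x̄₁) = 0` (`exists_root_of_not_hasNonsingularReduction`: the equation
divided by `π³`). For two bad points over the *same* root `r`, `N = x² + xx' + x'² + a₂(x + x') +
a₄ − a₁y' = π²(P'(r) + …)` with `P'(r) ≠ 0` (the roots are simple, `ne_zero_of_cubicDiscr_ne_zero`)
and `π² ∣ D`, so their sum is in `E₀(K)` (`hasNonsingularReduction_add_of_slope`, `e = 2`); in
particular every class of `E(K)/E₀(K)` is killed by `2`, and two bad points over the same root are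
congruent (`−P'` lies over the same root). Hence the root map embeds the non-zero classes into
the at most three `k`-roots of `P` (`natCard_quotient_le_four`), the quotient has order `≤ 4` and
exponent `2`, so order `1`, `2` or `4` (`natCard_mem_of_le_four_of_two_nsmul`). The index is the
same for `I` (`index_nonsingularReductionSubgroup_smul`), and this is `c_v` at a place `v`.

## References

* J. H. Silverman, *Advanced Topics in the Arithmetic of Elliptic Curves*, GTM 151, Springer
  1994, IV.9.4 Step 6 (PDF p. 345) and its proof (PDF pp. 350–352; Table 4.1: component group
  `(ℤ/2ℤ)²`). [SilvermanATAEC1994]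
-/

noncomputable section

open scoped Classical

open IsLocalRing Polynomial

namespace Literature.NumberTheory.EllipticCurves

namespace LocalIndex

open DiophantineGeometry DiophantineGeometry.TateAlgorithm

variable {R : Type*} [CommRing R] [IsDomain R] [IsDiscreteValuationRing R]

/-! ### Step 6 fired: the normal form -/

/-- **The normal form of type `I₀*`.** Over a perfect residue field, if Tate's algorithm returns
`Istar 0` on `V` (`Δ ≠ 0`) then some `R`-model `D • V` has `π ∣ a₁, a₂`, `π² ∣ a₃, a₄`, `π³ ∣ a₆`
and its Step-6 cubic has three distinct roots in `k̄` (Silverman, *ATAEC*, IV.9.4 Step 6).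
[cite: SilvermanATAEC1994, IV.9.4 Step 6] -/
theorem exists_smul_of_kodairaSymbolOfMinimal_eq_Istar_zero [PerfectField (ResidueField R)]
    (V : WeierstrassCurve R) (hΔ0 : V.Δ ≠ 0) (hV : V.kodairaSymbolOfMinimal = .Istar 0) :
    ∃ D : WeierstrassCurve.VariableChange R,
      (D • V).a₁ ∈ maximalIdeal R ∧ (D • V).a₂ ∈ maximalIdeal R ∧
      (D • V).a₃ ∈ maximalIdeal R ^ 2 ∧ (D • V).a₄ ∈ maximalIdeal R ^ 2 ∧
      (D • V).a₆ ∈ maximalIdeal R ^ 3 ∧ distinctRootCount (cubicStep6 (D • V)) = 3 := by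
  obtain ⟨h1, h2, h3, h4, h5, h6⟩ := kodairaSymbolOfMinimal_eq_Istar_zero_imp V hΔ0 hV
  have hex2 := exists_variableChange_step2_of_perfectField V h1
  have hN2 : normalizeStep2 V = hex2.choose • V := dif_pos hex2
  obtain ⟨-, hA₃, hA₄, -⟩ := hex2.choose_spec
  rw [hN2] at h2 h3 h4 h5 h6
  have hex6 := exists_variableChange_step6_of_perfectField h2 hA₃ hA₄ h3 h5 h4
  have hN6 : normalizeStep6 (hex2.choose • V) = hex6.choose • (hex2.choose • V) := dif_pos hex6
  obtain ⟨-, hB₁, hB₂, hB₃, hB₄, hB₆⟩ := hex6.choose_spec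
  rw [hN6] at h6
  refine ⟨hex6.choose * hex2.choose, ?_⟩
  rw [mul_smul]
  exact ⟨hB₁, hB₂, hB₃, hB₄, hB₆, h6⟩

/-! ### Bad points and the roots of `P(T)` -/

/-- A root of a cubic with non-zero discriminant is simple: if `f(r) = f'(r) = 0` for
`f = T³ + pT² + qT + w` then the discriminant vanishes (write `q`, `w` in terms of `p`, `r`).
[folklore] -/
theorem cubicDiscr_eq_zero_of_double_root {F : Type*} [CommRing F] {p q w r : F}
    (hf : r ^ 3 + p * r ^ 2 + q * r + w = 0) (hf' : 3 * r ^ 2 + 2 * p * r + q = 0) :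
    p ^ 2 * q ^ 2 - 4 * q ^ 3 - 4 * p ^ 3 * w - 27 * w ^ 2 + 18 * p * q * w = 0 := by
  have hq : q = -3 * r ^ 2 - 2 * p * r := by linear_combination hf'
  have hw : w = 2 * r ^ 3 + p * r ^ 2 := by linear_combination hf + (-r) * hf'
  rw [hq, hw]; ring

variable {K : Type*} [Field K] [Algebra R K] [IsFractionRing R K]

/-- **Bad points of the `I₀*` normal form lie over roots of `P(T)`.** If `a₁ = πα`, `a₂ = πβ`,
`a₃ = π²γ`, `a₄ = π²δ`, `a₆ = π³ε` then a point of `J(K)` without nonsingular reduction is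
`(πx₁, π²y₂)` with `x₁³ + βx₁² + δx₁ + ε = π(y₂² + αx₁y₂ + γy₂)`, so `x̄₁` is a root of
`P(T) = T³ + β̄T² + δ̄T + ε̄` (the equation divided by `π³`; Silverman, *ATAEC*, IV.9.4, proof of
Step 6). [cite: SilvermanATAEC1994, IV.9.4 Step 6] -/
theorem exists_root_of_not_hasNonsingularReduction (J : WeierstrassCurve R) {ϖ α β γ δ ε : R}
    (hϖ : Irreducible ϖ) (hα : J.a₁ = ϖ * α) (hβ : J.a₂ = ϖ * β) (hγ : J.a₃ = ϖ ^ 2 * γ)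
    (hδ : J.a₄ = ϖ ^ 2 * δ) (hε : J.a₆ = ϖ ^ 3 * ε) {P : (J.baseChange K).toAffine.Point}
    (hP : ¬ J.HasNonsingularReduction P) :
    ∃ (x₁ y₂ : R) (h : (J.baseChange K).toAffine.Nonsingular (algebraMap R K (ϖ * x₁))
      (algebraMap R K (ϖ ^ 2 * y₂))), P = .some _ _ h ∧
        x₁ ^ 3 + β * x₁ ^ 2 + δ * x₁ + ε = ϖ * (y₂ ^ 2 + α * x₁ * y₂ + γ * y₂) := by
  have hϖ0 : ϖ ≠ 0 := hϖ.ne_zero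
  have hm : ϖ ∈ maximalIdeal R := (IsLocalRing.mem_maximalIdeal _).mpr hϖ.not_isUnit
  have h3 : J.a₃ ∈ maximalIdeal R :=
    hγ ▸ Ideal.mul_mem_right _ _ (Ideal.pow_mem_of_mem _ hm 2 two_pos)
  have h4 : J.a₄ ∈ maximalIdeal R :=
    hδ ▸ Ideal.mul_mem_right _ _ (Ideal.pow_mem_of_mem _ hm 2 two_pos)
  have h6 : J.a₆ ∈ maximalIdeal R :=
    hε ▸ Ideal.mul_mem_right _ _ (Ideal.pow_mem_of_mem _ hm 3 three_pos)
  obtain ⟨x, y, h, rfl, hx, hy⟩ := exists_eq_some_of_not_hasNonsingularReduction J h3 h4 h6 hP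
  have he : J.toAffine.Equation x y :=
    (WeierstrassCurve.Affine.map_equation _ (IsFractionRing.injective R K) _ _).mp h.left
  obtain ⟨x₁, rfl⟩ := (mem_maximalIdeal_iff_dvd_of_irreducible hϖ x).mp hx
  obtain ⟨y₀, rfl⟩ := (mem_maximalIdeal_iff_dvd_of_irreducible hϖ y).mp hy
  rw [WeierstrassCurve.Affine.equation_iff, hα, hβ, hγ, hδ, hε] at he
  -- `π ∣ y₀`
  have hy₀ : ϖ ∣ y₀ := by
    refine hϖ.prime.dvd_of_dvd_pow (n := 2) ((mul_dvd_mul_iff_left (pow_ne_zero 2 hϖ0)).mp ?_)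
    exact ⟨x₁ ^ 3 + β * x₁ ^ 2 + δ * x₁ + ε - α * x₁ * y₀ - γ * y₀, by linear_combination he⟩
  obtain ⟨y₂, rfl⟩ := hy₀
  refine ⟨x₁, y₂, (by ring_nf; ring_nf at h; exact h), ?_, ?_⟩
  · exact point_some_congr rfl (by simp only [map_mul, map_pow]; ring)
  · exact mul_left_cancel₀ (pow_ne_zero 3 hϖ0) (by linear_combination -he)

/-- **Two bad points over the same simple root add up into `E₀(K)`** (normal form of type
`I₀*`): for `P = (πx₁, π²y₂)`, `P' = (πx₁', π²y₂')` with `x̄₁ = x̄₁'` a simple root of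
`P(T) = T³ + β̄T² + δ̄T + ε̄`, `N = π²·(3x̄₁² + 2β̄x̄₁ + δ̄ + …)` is `π²` times a unit and
`π² ∣ D`, so
`hasNonsingularReduction_add_of_slope` applies with `e = 2`. In particular each bad point has order
`2` modulo `E₀(K)` and bad points over the same root are congruent (Silverman, *ATAEC*, IV.9.4
Step 6 with Table 4.1: `Φ = (ℤ/2ℤ)²`). [cite: SilvermanATAEC1994, IV.9.4 Step 6] -/
theorem hasNonsingularReduction_add_of_same_root (J : WeierstrassCurve R) {ϖ α β γ δ ε : R}
    (hϖ : Irreducible ϖ) (hα : J.a₁ = ϖ * α) (hβ : J.a₂ = ϖ * β) (hγ : J.a₃ = ϖ ^ 2 * γ)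
    (hδ : J.a₄ = ϖ ^ 2 * δ) (hε : J.a₆ = ϖ ^ 3 * ε) {x₁ y₂ x₁' y₂' : R}
    (hroot : residue R x₁ = residue R x₁')
    (hsimple : 3 * residue R x₁ ^ 2 + 2 * residue R β * residue R x₁ + residue R δ ≠ 0)
    (h₁ : (J.baseChange K).toAffine.Nonsingular (algebraMap R K (ϖ * x₁))
      (algebraMap R K (ϖ ^ 2 * y₂)))
    (h₂ : (J.baseChange K).toAffine.Nonsingular (algebraMap R K (ϖ * x₁'))
      (algebraMap R K (ϖ ^ 2 * y₂'))) :
    J.HasNonsingularReduction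
      (WeierstrassCurve.Affine.Point.some _ _ h₁ + WeierstrassCurve.Affine.Point.some _ _ h₂) := by
  have hm : ϖ ∈ maximalIdeal R := (IsLocalRing.mem_maximalIdeal _).mpr hϖ.not_isUnit
  have h1 : J.a₁ ∈ maximalIdeal R := hα ▸ Ideal.mul_mem_right _ _ hm
  have h2 : J.a₂ ∈ maximalIdeal R := hβ ▸ Ideal.mul_mem_right _ _ hm
  have h3 : J.a₃ ∈ maximalIdeal R :=
    hγ ▸ Ideal.mul_mem_right _ _ (Ideal.pow_mem_of_mem _ hm 2 two_pos)
  have h4 : J.a₄ ∈ maximalIdeal R :=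
    hδ ▸ Ideal.mul_mem_right _ _ (Ideal.pow_mem_of_mem _ hm 2 two_pos)
  have h6 : J.a₆ ∈ maximalIdeal R :=
    hε ▸ Ideal.mul_mem_right _ _ (Ideal.pow_mem_of_mem _ hm 3 three_pos)
  have hu : IsUnit (x₁ ^ 2 + x₁ * x₁' + x₁' ^ 2 + β * (x₁ + x₁') + δ - ϖ * α * y₂') := by
    rw [isUnit_iff_residue_ne_zero]
    simp only [map_sub, map_add, map_mul, map_pow, (residue_eq_zero_iff _).mpr hm, zero_mul,
      sub_zero, ← hroot]
    convert hsimple using 1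
    ring
  refine hasNonsingularReduction_add_of_slope J hϖ 2 h1 h2 h3 h4 h6
    (Ideal.mul_mem_right _ _ hm) (Ideal.mul_mem_right _ _ hm) hu ?_ ?_ h₁ h₂
  · rw [hβ, hδ, hα]; ring
  · rw [hα, hγ]; exact ⟨y₂ + y₂' + α * x₁ + γ, by ring⟩

/-! ### Counting: at most four classes, none of order three -/

omit [IsDomain R] [IsDiscreteValuationRing R] in
/-- A finite abelian group of order `≤ 4` in which `2x = 0` for all `x` has order `1`, `2` or `4`
(order `3` would make it cyclic of order `3`). [folklore] -/
theorem natCard_mem_of_le_four_of_two_nsmul {G : Type*} [AddCommGroup G] [Finite G]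
    (hle : Nat.card G ≤ 4) (h2 : ∀ x : G, 2 • x = 0) :
    Nat.card G = 1 ∨ Nat.card G = 2 ∨ Nat.card G = 4 := by
  have hpos : 0 < Nat.card G := Nat.card_pos
  have h3 : Nat.card G ≠ 3 := by
    intro h3
    haveI : Fact (Nat.Prime 3) := ⟨Nat.prime_three⟩
    letI := Fintype.ofFinite G
    obtain ⟨g, hg⟩ := exists_prime_addOrderOf_dvd_card (G := G) 3
      (by rw [← Nat.card_eq_fintype_card, h3])
    have hdvd : addOrderOf g ∣ 2 := addOrderOf_dvd_iff_nsmul_eq_zero.mpr (h2 g)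
    rw [hg] at hdvd
    omega
  omega

/-! ### The index for the normal form -/

/-- **`[E(K) : E₀(K)] ∈ {1, 2, 4}` for the normal form of type `I₀*`** (`π ∣ a₁, a₂`,
`π² ∣ a₃, a₄`, `π³ ∣ a₆`, Step-6 cubic with three distinct roots): the root map embeds the
non-zero classes of `E(K)/E₀(K)` into the `k`-roots of the cubic (at most three), and every class
is killed by `2`. [cite: SilvermanATAEC1994, IV.9.4 Step 6] -/
theorem index_mem_of_normalForm_Istar_zero (J : WeierstrassCurve R)
    (h1 : J.a₁ ∈ maximalIdeal R) (h2 : J.a₂ ∈ maximalIdeal R) (h3 : J.a₃ ∈ maximalIdeal R ^ 2)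
    (h4 : J.a₄ ∈ maximalIdeal R ^ 2) (h6 : J.a₆ ∈ maximalIdeal R ^ 3)
    (hP3 : distinctRootCount (cubicStep6 J) = 3) :
    (J.nonsingularReductionSubgroup (integers_valuationRing_valuation R K)).index = 1 ∨
      (J.nonsingularReductionSubgroup (integers_valuationRing_valuation R K)).index = 2 ∨
      (J.nonsingularReductionSubgroup (integers_valuationRing_valuation R K)).index = 4 := by
  have hϖ : Irreducible (uniformizer R) := irreducible_uniformizer
  set ϖ := uniformizer R with hϖdef
  set H := J.nonsingularReductionSubgroup (integers_valuationRing_valuation R K) with hH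
  -- parameters
  obtain ⟨α, hα⟩ := mem_maximalIdeal_iff_dvd.mp h1
  obtain ⟨β, hβ⟩ := mem_maximalIdeal_iff_dvd.mp h2
  obtain ⟨γ, hγ⟩ := mem_maximalIdeal_pow_iff_dvd.mp h3
  obtain ⟨δ, hδ⟩ := mem_maximalIdeal_pow_iff_dvd.mp h4
  obtain ⟨ε, hε⟩ := mem_maximalIdeal_pow_iff_dvd.mp h6
  -- the cubic and its (simple) roots in `k`
  have hPeq : cubicStep6 J = X ^ 3 + C (residue R β) * X ^ 2 + C (residue R δ) * X +
      C (residue R ε) := by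
    simp only [cubicStep6, hβ, hδ, hε, redCoeff_uniformizer_mul, redCoeff_uniformizer_pow_mul]
  have hdisc := (distinctRootCount_cubic_eq_three_iff _ _ _).mp (hPeq ▸ hP3)
  have hsimple : ∀ r : ResidueField R,
      r ^ 3 + residue R β * r ^ 2 + residue R δ * r + residue R ε = 0 →
        3 * r ^ 2 + 2 * residue R β * r + residue R δ ≠ 0 :=
    fun r hr hr' => hdisc (cubicDiscr_eq_zero_of_double_root hr hr')
  set f : (ResidueField R)[X] := X ^ 3 + C (residue R β) * X ^ 2 + C (residue R δ) * X +
    C (residue R ε) with hf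
  have hf0 : f ≠ 0 := by
    have hm : f.Monic := by rw [hf]; monicity!
    exact hm.ne_zero
  have hfdeg : f.natDegree ≤ 3 := by rw [hf]; compute_degree!
  have hfeval : ∀ r, f.eval r = r ^ 3 + residue R β * r ^ 2 + residue R δ * r + residue R ε := by
    intro r; simp [hf]
  set S : Finset (ResidueField R) := f.roots.toFinset with hS
  have hScard : S.card ≤ 3 :=
    (Multiset.toFinset_card_le _).trans ((Polynomial.card_roots' f).trans hfdeg)
  have hmemS : ∀ r, r ∈ S ↔ r ^ 3 + residue R β * r ^ 2 + residue R δ * r + residue R ε = 0 := by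
    intro r
    rw [hS, Multiset.mem_toFinset, Polynomial.mem_roots hf0, Polynomial.IsRoot.def, hfeval]
  -- bad points: coordinates and roots
  have hbad : ∀ P : (J.baseChange K).toAffine.Point, ¬ J.HasNonsingularReduction P →
      ∃ (x₁ y₂ : R) (h : (J.baseChange K).toAffine.Nonsingular (algebraMap R K (ϖ * x₁))
        (algebraMap R K (ϖ ^ 2 * y₂))), P = .some _ _ h ∧ residue R x₁ ∈ S := by
    intro P hP
    obtain ⟨x₁, y₂, h, rfl, hid⟩ :=
      exists_root_of_not_hasNonsingularReduction J hϖ hα hβ hγ hδ hε hP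
    refine ⟨x₁, y₂, h, rfl, (hmemS _).mpr ?_⟩
    have := congrArg (residue R) hid
    simpa [(residue_eq_zero_iff _).mpr ((IsLocalRing.mem_maximalIdeal _).mpr hϖ.not_isUnit)]
      using this
  choose! fx fy fh hPeq' hroot using hbad
  -- two bad points over the same root are congruent modulo `H`
  have hcongr : ∀ P Q : (J.baseChange K).toAffine.Point, ¬ J.HasNonsingularReduction P →
      ¬ J.HasNonsingularReduction Q → residue R (fx P) = residue R (fx Q) → P - Q ∈ H := by
    intro P Q hP hQ hPQ
    rw [hPeq' P hP, hPeq' Q hQ, sub_eq_add_neg, WeierstrassCurve.Affine.Point.neg_some]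
    have hneg : (J.baseChange K).toAffine.negY (algebraMap R K (ϖ * fx Q))
        (algebraMap R K (ϖ ^ 2 * fy Q)) =
          algebraMap R K (ϖ ^ 2 * (-fy Q - α * fx Q - γ)) := by
      rw [WeierstrassCurve.Affine.negY]
      simp only [WeierstrassCurve.baseChange, WeierstrassCurve.map_a₁, WeierstrassCurve.map_a₃,
        hα, hγ, map_neg, map_sub, map_mul, map_pow]
      ring
    rw [point_some_congr rfl hneg (h' := hneg ▸ (WeierstrassCurve.Affine.nonsingular_neg _ _).mpr
      (fh Q hQ))]
    rw [hH, WeierstrassCurve.mem_nonsingularReductionSubgroup_iff]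
    exact hasNonsingularReduction_add_of_same_root J hϖ hα hβ hγ hδ hε hPQ
      (hsimple _ ((hmemS _).mp (hroot P hP))) (fh P hP) _
  -- the root map on the quotient is injective
  set Q := (J.baseChange K).toAffine.Point ⧸ H with hQ
  let F : Q → Option S := fun q =>
    if hq : J.HasNonsingularReduction q.out then none
    else some ⟨residue R (fx q.out), hroot _ hq⟩
  have hF : Function.Injective F := by
    intro q q' hqq'
    simp only [F] at hqq'
    by_cases hq : J.HasNonsingularReduction q.out <;>
      by_cases hq' : J.HasNonsingularReduction q'.out
    · rw [← QuotientAddGroup.out_eq' q, ← QuotientAddGroup.out_eq' q',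
        (QuotientAddGroup.eq_zero_iff _).mpr
          ((WeierstrassCurve.mem_nonsingularReductionSubgroup_iff _).mpr hq),
        (QuotientAddGroup.eq_zero_iff _).mpr
          ((WeierstrassCurve.mem_nonsingularReductionSubgroup_iff _).mpr hq')]
    · rw [dif_pos hq, dif_neg hq'] at hqq'; exact absurd hqq' (Option.some_ne_none _).symm
    · rw [dif_neg hq, dif_pos hq'] at hqq'; exact absurd hqq' (Option.some_ne_none _)
    · rw [dif_neg hq, dif_neg hq', Option.some_inj, Subtype.mk.injEq] at hqq'
      rw [← QuotientAddGroup.out_eq' q, ← QuotientAddGroup.out_eq' q',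
        QuotientAddGroup.eq_iff_sub_mem]
      exact hcongr _ _ hq hq' hqq'
  haveI : Finite Q := Finite.of_injective F hF
  -- at most four classes
  have hle : Nat.card Q ≤ 4 := by
    refine (Nat.card_le_card_of_injective F hF).trans ?_
    rw [Nat.card_eq_fintype_card, Fintype.card_option, Fintype.card_coe]
    omega
  -- every class is killed by `2`
  have h2 : ∀ q : Q, 2 • q = 0 := by
    intro q
    induction q using QuotientAddGroup.induction_on with
    | H P =>
      rw [← QuotientAddGroup.mk_nsmul, two_nsmul, QuotientAddGroup.eq_zero_iff]
      by_cases hP : J.HasNonsingularReduction P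
      · exact H.add_mem ((WeierstrassCurve.mem_nonsingularReductionSubgroup_iff _).mpr hP)
          ((WeierstrassCurve.mem_nonsingularReductionSubgroup_iff _).mpr hP)
      · rw [hPeq' P hP, hH, WeierstrassCurve.mem_nonsingularReductionSubgroup_iff]
        exact hasNonsingularReduction_add_of_same_root J hϖ hα hβ hγ hδ hε rfl
          (hsimple _ ((hmemS _).mp (hroot P hP))) (fh P hP) (fh P hP)
  exact natCard_mem_of_le_four_of_two_nsmul hle h2

/-- **`[E(K) : E₀(K)] ∈ {1, 2, 4}` for type `I₀*`** over a discrete valuation ring with perfect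
residue field (Silverman, *ATAEC*, IV.9.4 Step 6: `c = 1 + #{α ∈ k : P(α) = 0}`), for an equation
`I` with `Δ ≠ 0`: normal form, index for the normal form, invariance of the index under
`R`-changes of variables. [cite: SilvermanATAEC1994, IV.9.4 Step 6] -/
theorem index_mem_of_kodairaSymbolOfMinimal_eq_Istar_zero [PerfectField (ResidueField R)]
    (I : WeierstrassCurve R) (hΔ : I.Δ ≠ 0) (hI : I.kodairaSymbolOfMinimal = .Istar 0) :
    (I.nonsingularReductionSubgroup (integers_valuationRing_valuation R K)).index = 1 ∨
      (I.nonsingularReductionSubgroup (integers_valuationRing_valuation R K)).index = 2 ∨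
      (I.nonsingularReductionSubgroup (integers_valuationRing_valuation R K)).index = 4 := by
  obtain ⟨D, h1, h2, h3, h4, h6, hP3⟩ :=
    exists_smul_of_kodairaSymbolOfMinimal_eq_Istar_zero I hΔ hI
  rw [← index_nonsingularReductionSubgroup_smul I D]
  exact index_mem_of_normalForm_Istar_zero (D • I) h1 h2 h3 h4 h6 hP3

end LocalIndex

/-! ### The discharge -/

section Discharge

open IsDedekindDomain

variable {A : Type*} [CommRing A] [IsDedekindDomain A] {K : Type*} [Field K] [Algebra A K]
  [IsFractionRing A K] (v : HeightOneSpectrum A) (W : WeierstrassCurve K)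

/-- **Discharge of `localTamagawaNumber_of_kodairaSymbolAt_eq_Istar_zero`**: `c_v ∈ {1, 2, 4}`
for type `I₀*` (Silverman, *ATAEC*, IV.9.4 Step 6, PDF p. 345), by the elementary argument of this
file. [cite: SilvermanATAEC1994, IV.9.4 Step 6 (PDF p. 345)] -/
theorem localTamagawaNumber_of_kodairaSymbolAt_eq_Istar_zero_holds :
    localTamagawaNumber_of_kodairaSymbolAt_eq_Istar_zero v W := by
  intro _ _ hk
  rw [WeierstrassCurve.kodairaSymbolAt_def] at hk
  haveI := W.isElliptic_localMinimalModel v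
  change ((W.localMinimalModel v).goodReductionSubgroup (v.adicCompletionIntegers K)).index = 1 ∨
    ((W.localMinimalModel v).goodReductionSubgroup (v.adicCompletionIntegers K)).index = 2 ∨
    ((W.localMinimalModel v).goodReductionSubgroup (v.adicCompletionIntegers K)).index = 4
  have key : ∀ (M : WeierstrassCurve (v.adicCompletion K))
      [M.IsMinimal (v.adicCompletionIntegers K)] [M.IsElliptic],
      (M.integralModel (v.adicCompletionIntegers K)).kodairaSymbolOfMinimal = .Istar 0 →
        (M.goodReductionSubgroup (v.adicCompletionIntegers K)).index = 1 ∨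
        (M.goodReductionSubgroup (v.adicCompletionIntegers K)).index = 2 ∨
        (M.goodReductionSubgroup (v.adicCompletionIntegers K)).index = 4 := by
    intro M _ _ hM
    obtain ⟨I, rfl⟩ : ∃ I : WeierstrassCurve (v.adicCompletionIntegers K),
        M = I.baseChange (v.adicCompletion K) := WeierstrassCurve.IsIntegral.integral
    rw [WeierstrassCurve.integralModel_baseChange_eq] at hM
    rw [WeierstrassCurve.goodReductionSubgroup_baseChange_eq]
    refine LocalIndex.index_mem_of_kodairaSymbolOfMinimal_eq_Istar_zero I ?_ hM
    intro h0
    apply (I.baseChange (v.adicCompletion K)).Δ'.ne_zero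
    rw [WeierstrassCurve.coe_Δ', WeierstrassCurve.baseChange, WeierstrassCurve.map_Δ, h0, map_zero]
  exact key (W.localMinimalModel v) hk

end Discharge

end Literature.NumberTheory.EllipticCurves

end
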